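import Summits.HodgeConjecture.CorCM.GaloisSectionCountFixed
import Summits.HodgeConjecture.CorCM.GaloisPrimeOrderPairSubgroup
import Mathlib.GroupTheory.Coset.Card
import Mathlib.GroupTheory.GroupAction.Quotient
import Mathlib.Tactic.Group
import Mathlib.Tactic.FinCases
import HarnessLib

/-!
# A NON-NORMAL SUBGROUP OF PRIME ORDER yields a SKEW CM set (trivial left stabiliser, non-trivial right stabiliser) — the
# group core; prime-order sequel of `CorCM/GaloisSkewSection` (`p = 2`)

COR-CM (cell `pub-hodgecm2`), binder seat b04 (gen 33), count-neutral own lane «Galois-CM-type classification».  KERNEL ONLY,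
Mathlib only: theorems; no definition, no named fact, no `sorry`.  Uses `CorCM/GaloisSectionCountFixed` (gen 32: twisted-invariant
Boolean functions under a permutation with fixed points) and `CorCM/GaloisPrimeOrderPowerSets` / `…PairSubgroup` (gen 33); feeder of
`CorCM/GaloisNonNormalPrimeOrder` (the Galois dress through gen 23's `GaloisModels.exists_simple_degenerate_of_model_skew`: a skew CM
set is read by a PRIMITIVE DEGENERATE CM type).

SETTING.  `G` finite, `c ∈ Z(G)` an involution (complex conjugation), `u ∈ G` of PRIME order `p` with `c ∉ ⟨u⟩` (automatic for odd
`p`) and `⟨u⟩` NOT normal.  `H = ⟨u, c⟩ = {uʲ, c uʲ}` (cyclic of order `2p`), `P = G/H` (`|P| = n = |G|/(2p)`), `rep : P → G`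
representatives, `x` UPPER iff `rep(x̄)⁻¹ x ∈ c⟨u⟩`.  For `ε : P → Bool` the section set `T_ε = {x : upper(x) = ε(x̄)}` is CM for `c`
and right `u`-invariant, and a left stabiliser `v` forces the twisted system `ε(v·q) = ε(q) ⊻ upper(v·rep q)` (§3.5, as in gen 32).
NEW (§3.6–3.8): a fixed point `q` of `v ≠ 1` with trivial twist puts `v` in the conjugate `K_q = rep(q)⟨u⟩rep(q)⁻¹`; since the order
is PRIME, `K_q` is then the power set of `v`, so ALL such `q` lie in ONE fibre of the `G`-equivariant map `q ↦ K_q`; the fibres all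
have size `s = n/m`, `m` = the number of conjugates of `⟨u⟩`, and the `v ≠ 1` occurring at all number `≤ m(p-1)`.  Union bound:
`|G|·2^(n/2) + m(p-1)·2^((n + n/m)/2) < 2^n` ⟹ some `ε` violates every system:

* **`exists_skew_of_prime_order_family`** — with `m₀` exhibited conjugators `g_i` (`g_j⁻¹ g_i ∉ N(⟨u⟩)` for `i < j`) and the count
  for every `m ≥ m₀` dividing `n`: a CM set `T` with trivial left stabiliser and `T u = T` exists.
* **`exists_skew_of_nonnormal_prime_order`** — `m₀ = 2`: `⟨u⟩` not normal and the count for every `m ≥ 2`, `m ∣ n` (here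
  `c ∉ ⟨u⟩` is automatic: `ne_pow_of_nonnormal`).
* `commute_of_conj_eq_pow` (§4, for the contrapositive's corollary) — two elements of prime orders normalising each other's cyclic
  group commute.
Clean size conditions implying the count (`p = 3`: `|G| ≥ 96`; any `p`: `n ≥ 16`, `8p ≤ 2^(n/4)`; `p = 2`: `|G| ≥ 64` = gen 32)
are in `CorCM/GaloisSkewCountPrime`.  Seat census: skew sections of this shape exist far below the counting threshold (`A₄ × C₄`:
144 of 256 sections; `SL(2,3) × C₂`: 192 of 256); the count succeeds for `SL(2,3) × C₄`, `A₄ × C₈` (96), `(C₇ ⋊ C₃) × C₄` (84, `m = 7`).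

## References

* [Shimura1998] G. Shimura, *Abelian Varieties with Complex Multiplication and Modular Functions*, §8.2 Prop. 26, §32.10.
* [Kubota1965] T. Kubota, *On the field extension by complex multiplication*, Trans. AMS 118 (1965), §2 (context only).
-/

namespace Summit.HodgeConjecture.CorCM.GaloisModels.SkewSectionPrime

open Finset
variable {G : Type*} [Group G] [DecidableEq G] [Fintype G]

/-! ## §3 The skew section -/

/-- **A NON-NORMAL SUBGROUP OF PRIME ORDER YIELDS A SKEW CM SET** (family form).  `c` a central involution, `u` of prime order `p`
with `c ∉ ⟨u⟩`, `|G| = 2pn`; `g : Fin m₀ → G` conjugating `⟨u⟩` to `m₀` pairwise distinct subgroups; and the count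
`|G|·2^(n/2) + m (p-1) 2^((n + n/m)/2) < 2^n` for every `m ≥ m₀` dividing `n`.  Then some `T ⊆ G` has `x ∈ T ↔ cx ∉ T`, trivial
left stabiliser, and `T u = T`. [folklore] -/
theorem exists_skew_of_prime_order_family (c u : G) (p n m₀ : ℕ) [hp : Fact p.Prime]
    (hcc : c * c = 1) (hcen : ∀ g : G, c * g = g * c) (hup : u ^ p = 1) (hu1 : u ≠ 1)
    (hcU : ∀ j < p, c ≠ u ^ j) (hcard : Fintype.card G = 2 * p * n)
    (g : Fin m₀ → G) (hind : ∀ i j : Fin m₀, i < j → ∀ k < p, ((g j)⁻¹ * g i) * u * ((g j)⁻¹ * g i)⁻¹ ≠ u ^ k)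
    (hcount : ∀ m, m₀ ≤ m → m ∣ n → Fintype.card G * 2 ^ (n / 2) + m * (p - 1) * 2 ^ ((n + n / m) / 2) < 2 ^ n) :
    ∃ T : Finset G, (∀ x, x ∈ T ↔ c * x ∉ T) ∧ (∀ v : G, v ≠ 1 → ∃ w, ¬ (w ∈ T ↔ v * w ∈ T)) ∧
      (∀ x, x * u ∈ T ↔ x ∈ T) := by
  classical
  -- §3.1 arithmetic in `⟨u, c⟩`
  have hpos : 0 < p := hp.out.pos
  have hc1 : c ≠ 1 := fun h => hcU 0 hpos (by rw [pow_zero]; exact h)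
  have hord : orderOf u = p := orderOf_eq_prime hup hu1
  have hcu : c * u = u * c := hcen u
  have hmod : ∀ k, u ^ (k % p) = u ^ k := fun k => by rw [← hord]; exact pow_mod_orderOf u k
  have hcomm : ∀ j : ℕ, c * u ^ j = u ^ j * c := fun j => ((show Commute c u from hcu).pow_right j).eq
  have hexcl : ∀ i j : ℕ, u ^ i ≠ c * u ^ j := pow_ne_mul_pow hup hu1 hcU
  -- §3.2 the subgroup `H = ⟨u, c⟩ = {u^j, c u^j}` and its size `2p`
  set H : Subgroup G := Subgroup.closure ({u, c} : Set G) with hHdef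
  have hH : ∀ x, x ∈ H ↔ ∃ j < p, (x = u ^ j ∨ x = c * u ^ j) := mem_closure_pair_iff_of_pow_eq_one hpos hcc hup hcu
  have huH : u ∈ H := Subgroup.subset_closure (by simp)
  have hcH : c ∈ H := Subgroup.subset_closure (by simp)
  have hHcomm : ∀ w, w ∈ H → Commute w u := by
    intro w hw
    obtain ⟨j, -, rfl | rfl⟩ := (hH w).1 hw
    · exact Commute.pow_left (Commute.refl u) j
    · exact Commute.mul_left hcu (Commute.pow_left (Commute.refl u) j)
  have hHu : ∀ w, w ∈ H → ∀ i : ℕ, w * u ^ i * w⁻¹ = u ^ i := fun w hw i => by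
    rw [((hHcomm w hw).pow_right i).eq, mul_inv_cancel_right]
  have hHcard : Nat.card H = 2 * p := card_closure_pair c u p hcc hup hu1 hcu hcU
  -- §3.3 the coset space
  haveI : Fintype (G ⧸ H) := Fintype.ofFinite _
  have hGP : Nat.card G = Nat.card (G ⧸ H) * Nat.card H := Subgroup.card_eq_card_quotient_mul_card_subgroup H
  rw [Nat.card_eq_fintype_card, Nat.card_eq_fintype_card, hHcard, hcard] at hGP
  have hn : Fintype.card (G ⧸ H) = n := by
    have : (2 * p) * Fintype.card (G ⧸ H) = (2 * p) * n := by rw [mul_comm (2 * p) (Fintype.card _)]; exact hGP.symm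
    exact Nat.eq_of_mul_eq_mul_left (by omega) this
  set rep : G ⧸ H → G := Quotient.out with hrepdef
  have hrep : ∀ q : G ⧸ H, ((rep q : G) : G ⧸ H) = q := fun q => Quotient.out_eq q
  have hcoe : ∀ y w : G, w ∈ H → ((y * w : G) : G ⧸ H) = (y : G ⧸ H) := fun y w hw =>
    (QuotientGroup.eq.2 (by rw [inv_mul_cancel_left]; exact hw)).symm
  have hrepH : ∀ x : G, (rep (x : G ⧸ H))⁻¹ * x ∈ H := fun x => QuotientGroup.eq.1 (hrep _)
  have hsmulcoe : ∀ (g' : G) (q : G ⧸ H), ((g' * rep q : G) : G ⧸ H) = g' • q := fun g' q => by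
    rw [← smul_eq_mul, ← MulAction.Quotient.smul_coe, hrep]
  -- §3.4 the «upper» predicate
  set χ : G → Bool := fun w => decide (∃ j < p, w = c * u ^ j) with hχ
  have hχpow : ∀ j, χ (u ^ j) = false := fun j => by
    simp only [hχ, decide_eq_false_iff_not, not_exists, not_and]
    exact fun i _ h => hexcl j i h
  have hχcpow : ∀ j, χ (c * u ^ j) = true := fun j => by
    simp only [hχ, decide_eq_true_eq]
    exact ⟨j % p, Nat.mod_lt _ hpos, by rw [hmod]⟩
  have hχu : ∀ w, w ∈ H → χ (w * u) = χ w := by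
    intro w hw
    obtain ⟨j, -, rfl | rfl⟩ := (hH w).1 hw
    · rw [← pow_succ, hχpow, hχpow]
    · rw [mul_assoc, ← pow_succ, hχcpow, hχcpow]
  have hχc : ∀ w, w ∈ H → χ (w * c) = !χ w := by
    intro w hw
    obtain ⟨j, -, rfl | rfl⟩ := (hH w).1 hw
    · rw [← hcomm, hχcpow, hχpow]; rfl
    · rw [mul_assoc, ← hcomm, ← mul_assoc, hcc, one_mul, hχpow, hχcpow]; rfl
  have hχ1 : χ 1 = false := by rw [← pow_zero u]; exact hχpow 0
  set up : G → Bool := fun x => χ ((rep (x : G ⧸ H))⁻¹ * x) with hup'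
  have hupmul : ∀ y w : G, w ∈ H → up (y * w) = χ ((rep (y : G ⧸ H))⁻¹ * y * w) := by
    intro y w hw; simp only [hup']; rw [hcoe y w hw, ← mul_assoc]
  have hupu : ∀ y : G, up (y * u) = up y := fun y => by rw [hupmul y u huH, hχu _ (hrepH y)]
  have hupc : ∀ y : G, up (y * c) = !up y := fun y => by rw [hupmul y c hcH, hχc _ (hrepH y)]
  have huprep : ∀ q : G ⧸ H, up (rep q) = false := by
    intro q
    have e : rep ((rep q : G) : G ⧸ H) = rep q := by rw [hrep]
    simp only [hup', e, inv_mul_cancel]; exact hχ1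
  -- §3.5 the section sets: right `u`-invariance, CM, and the twisted system of a left stabiliser
  have hT : ∀ (ε : G ⧸ H → Bool) (x : G), x ∈ (Finset.univ.filter fun y : G => up y = ε (y : G ⧸ H)) ↔ up x = ε x :=
    fun ε x => by rw [Finset.mem_filter, and_iff_right (Finset.mem_univ x)]
  have hTu : ∀ (ε : G ⧸ H → Bool) (x : G), x * u ∈ (Finset.univ.filter fun y : G => up y = ε (y : G ⧸ H)) ↔
      x ∈ (Finset.univ.filter fun y : G => up y = ε (y : G ⧸ H)) := by
    intro ε x; rw [hT, hT, hupu, hcoe x u huH]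
  have hTc : ∀ (ε : G ⧸ H → Bool) (x : G), x ∈ (Finset.univ.filter fun y : G => up y = ε (y : G ⧸ H)) ↔
      c * x ∉ (Finset.univ.filter fun y : G => up y = ε (y : G ⧸ H)) := by
    intro ε x
    rw [hT, hT, hcen x, hupc, hcoe x c hcH]
    cases up x <;> cases ε (x : G ⧸ H) <;> simp
  have hstab : ∀ (ε : G ⧸ H → Bool) (v : G),
      (∀ x, x ∈ (Finset.univ.filter fun y : G => up y = ε (y : G ⧸ H)) ↔
        v * x ∈ (Finset.univ.filter fun y : G => up y = ε (y : G ⧸ H))) →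
      ∀ q : G ⧸ H, ε (v • q) = xor (ε q) (up (v * rep q)) := by
    intro ε v hv q
    have h1 := hv (rep q)
    rw [hT, hT, huprep, hrep, hsmulcoe] at h1
    have h2 := hv (rep q * c)
    rw [hT, hT, hupc, huprep, hcoe _ c hcH, hrep, ← mul_assoc, hupc, hcoe _ c hcH, hsmulcoe] at h2
    revert h1 h2
    cases ε q <;> cases ε (v • q) <;> cases up (v * rep q) <;> simp
  -- §3.6 conjugate power sets `K a = {a u^i a⁻¹ : i < p}`
  set K : G → Finset G := fun a => (Finset.range p).image (fun i => a * u ^ i * a⁻¹) with hKdef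
  have hKw : ∀ a w : G, w ∈ H → K (a * w) = K a := by
    intro a w hw
    simp only [hKdef]
    refine Finset.image_congr fun i _ => ?_
    calc a * w * u ^ i * (a * w)⁻¹ = a * (w * u ^ i * w⁻¹) * a⁻¹ := by group
      _ = a * u ^ i * a⁻¹ := by rw [hHu w hw i]
  have hKconj : ∀ g' a : G, K (g' * a) = (K a).image (fun x => g' * x * g'⁻¹) := by
    intro g' a
    simp only [hKdef, Finset.image_image]
    refine Finset.image_congr fun i _ => ?_
    simp only [Function.comp_apply]; group
  have hone_mem : ∀ a : G, (1 : G) ∈ K a := fun a =>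
    Finset.mem_image.2 ⟨0, Finset.mem_range.2 hpos, by rw [pow_zero, mul_one, mul_inv_cancel]⟩
  have hKcard : ∀ a : G, ((K a).erase 1).card ≤ p - 1 := fun a => by
    rw [Finset.card_erase_of_mem (hone_mem a)]
    exact Nat.sub_le_sub_right (Finset.card_image_le.trans (by rw [Finset.card_range])) 1
  have hKeq : ∀ (a b v : G), v ≠ 1 → v ∈ K a → v ∈ K b → K a = K b := fun a b v hv1 ha hb => by
    simp only [hKdef] at ha hb ⊢
    exact (image_conj_pow_eq_of_mem hord hv1 ha).trans (image_conj_pow_eq_of_mem hord hv1 hb).symm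
  -- the equivariant map `q ↦ K (rep q)` and its fibres
  have hrepsmul : ∀ (g' : G) (q : G ⧸ H), ∃ w ∈ H, rep (g' • q) = g' * rep q * w := by
    intro g' q
    refine ⟨(g' * rep q)⁻¹ * rep (g' • q), QuotientGroup.eq.1 (by rw [hsmulcoe, hrep]), ?_⟩
    rw [mul_inv_cancel_left]
  have hKsmul : ∀ (g' : G) (q : G ⧸ H), K (rep (g' • q)) = (K (rep q)).image (fun x => g' * x * g'⁻¹) := by
    intro g' q
    obtain ⟨w, hw, e⟩ := hrepsmul g' q
    rw [e, hKw _ w hw, hKconj]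
  have hfib : ∀ q₁ q₂ : G ⧸ H, (Finset.univ.filter fun q : G ⧸ H => K (rep q) = K (rep q₁)).card ≤
      (Finset.univ.filter fun q : G ⧸ H => K (rep q) = K (rep q₂)).card := by
    intro q₁ q₂
    set g' : G := rep q₂ * (rep q₁)⁻¹ with hg'
    have e2 : K (rep q₂) = (K (rep q₁)).image (fun x => g' * x * g'⁻¹) := by
      rw [← hKconj, hg', inv_mul_cancel_right]
    refine Finset.card_le_card_of_injOn (fun q => g' • q) (fun q hq => ?_) fun q₃ _ q₄ _ h => MulAction.injective g' h
    rw [Finset.mem_coe, Finset.mem_filter] at hq ⊢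
    exact ⟨Finset.mem_univ _, by rw [hKsmul, hq.2, e2]⟩
  set s : ℕ := (Finset.univ.filter fun q : G ⧸ H => K (rep q) = K (rep (((1 : G) : G ⧸ H)))).card with hsdef
  have hfibs : ∀ q₁ : G ⧸ H, (Finset.univ.filter fun q : G ⧸ H => K (rep q) = K (rep q₁)).card = s :=
    fun q₁ => le_antisymm (hfib _ _) (hfib _ _)
  set 𝒦 : Finset (Finset G) := Finset.univ.image (fun q : G ⧸ H => K (rep q)) with h𝒦def
  set m : ℕ := 𝒦.card with hmdef
  have hms : n = m * s := by
    rw [← hn, ← Finset.card_univ, Finset.card_eq_sum_card_fiberwise (f := fun q : G ⧸ H => K (rep q))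
      (t := 𝒦) (fun q _ => Finset.mem_image_of_mem _ (Finset.mem_univ q)), hmdef, ← smul_eq_mul, ← Finset.sum_const]
    refine Finset.sum_congr rfl fun Kq hKq => ?_
    obtain ⟨q₁, -, rfl⟩ := Finset.mem_image.1 hKq
    exact hfibs q₁
  -- `m ≥ m₀`: the conjugates by the family `g` are pairwise distinct
  have hKg : ∀ i : Fin m₀, K (rep ((g i : G) : G ⧸ H)) = K (g i) := by
    intro i
    have hw := hrepH (g i)
    have e : rep ((g i : G) : G ⧸ H) = g i * ((rep ((g i : G) : G ⧸ H))⁻¹ * g i)⁻¹ := by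
      rw [mul_inv_rev, inv_inv, mul_inv_cancel_left]
    rw [e, hKw _ _ (inv_mem hw)]
  have hm₀ : m₀ ≤ m := by
    have h := Finset.card_le_card_of_injOn (s := (Finset.univ : Finset (Fin m₀))) (t := 𝒦) (fun i => K (g i))
      (fun i _ => by
        rw [Finset.mem_coe, h𝒦def, Finset.mem_image]
        exact ⟨((g i : G) : G ⧸ H), Finset.mem_univ _, hKg i⟩)
      (by
        intro i _ j _ hij
        by_contra hne
        -- from `K (g i) = K (g j)`: `(g j)⁻¹ g i` and `(g i)⁻¹ g j` conjugate `u` into `⟨u⟩`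
        have key : ∀ i j : Fin m₀, K (g i) = K (g j) → ∃ k < p, ((g j)⁻¹ * g i) * u * ((g j)⁻¹ * g i)⁻¹ = u ^ k := by
          intro i j hK
          have hmem : g i * u ^ 1 * (g i)⁻¹ ∈ K (g j) := by
            rw [← hK]; exact Finset.mem_image.2 ⟨1, Finset.mem_range.2 hp.out.one_lt, rfl⟩
          obtain ⟨k, hk, hk'⟩ := Finset.mem_image.1 hmem
          refine ⟨k, Finset.mem_range.1 hk, ?_⟩
          rw [pow_one] at hk'
          calc (g j)⁻¹ * g i * u * ((g j)⁻¹ * g i)⁻¹ = (g j)⁻¹ * (g i * u * (g i)⁻¹) * g j := by group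
            _ = u ^ k := by rw [← hk']; group
        rcases lt_or_gt_of_ne hne with hlt | hlt
        · obtain ⟨k, hk, hk'⟩ := key i j hij
          exact hind i j hlt k hk hk'
        · obtain ⟨k, hk, hk'⟩ := key j i hij.symm
          exact hind j i hlt k hk hk')
    rwa [Finset.card_univ, Fintype.card_fin] at h
  have hmpos : 0 < m := by
    rw [hmdef]; exact Finset.card_pos.2 ⟨_, Finset.mem_image_of_mem _ (Finset.mem_univ (((1 : G) : G ⧸ H)))⟩
  have hsdiv : m ∣ n := ⟨s, hms⟩
  have hsn : s = n / m := by rw [hms, Nat.mul_div_cancel_left _ hmpos]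
  -- §3.7 fixed points with trivial twist lie in one fibre
  have hfix : ∀ (v : G), v ≠ 1 → ∀ q : G ⧸ H, v • q = q → up (v * rep q) = false → v ∈ K (rep q) := by
    intro v hv q hq hupv
    have hw : (rep q)⁻¹ * (v * rep q) ∈ H := by
      have := hrepH (v * rep q); rwa [hsmulcoe, hq] at this
    have hup2 : up (v * rep q) = χ ((rep q)⁻¹ * (v * rep q)) := by simp only [hup', hsmulcoe, hq]
    rw [hup2] at hupv
    obtain ⟨j, hj, h | h⟩ := (hH _).1 hw
    · refine Finset.mem_image.2 ⟨j, Finset.mem_range.2 hj, ?_⟩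
      rw [← h]; group
    · rw [h, hχcpow] at hupv; exact absurd hupv (by decide)
  set V := (Finset.univ : Finset G).erase 1 with hVdef
  set V₁ := V.filter (fun v => ∃ q : G ⧸ H, v ∈ K (rep q)) with hV₁def
  have hFix1 : ∀ v ∈ V₁, (Finset.univ.filter fun q : G ⧸ H => v • q = q ∧ up (v * rep q) = false).card ≤ s := by
    intro v hv
    obtain ⟨hvV, q₀, hq₀⟩ := Finset.mem_filter.1 hv
    have hv1 : v ≠ 1 := (Finset.mem_erase.1 hvV).1
    rw [← hfibs q₀]
    refine Finset.card_le_card fun q hq => ?_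
    rw [Finset.mem_filter] at hq ⊢
    exact ⟨Finset.mem_univ _, hKeq _ _ v hv1 (hfix v hv1 q hq.2.1 hq.2.2) hq₀⟩
  have hFix0 : ∀ v ∈ V, v ∉ V₁ → (Finset.univ.filter fun q : G ⧸ H => v • q = q ∧ up (v * rep q) = false).card = 0 := by
    intro v hv hv₁
    rw [Finset.card_eq_zero, Finset.filter_eq_empty_iff]
    intro q _ hq
    exact hv₁ (Finset.mem_filter.2 ⟨hv, q, hfix v (Finset.mem_erase.1 hv).1 q hq.1 hq.2⟩)
  have hV₁card : V₁.card ≤ m * (p - 1) := by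
    have hsub : V₁ ⊆ 𝒦.biUnion fun Kq => Kq.erase 1 := by
      intro v hv
      obtain ⟨hvV, q₀, hq₀⟩ := Finset.mem_filter.1 hv
      exact Finset.mem_biUnion.2 ⟨K (rep q₀), Finset.mem_image_of_mem _ (Finset.mem_univ _),
        Finset.mem_erase.2 ⟨(Finset.mem_erase.1 hvV).1, hq₀⟩⟩
    refine (Finset.card_le_card hsub).trans (Finset.card_biUnion_le.trans ?_)
    rw [hmdef, ← smul_eq_mul, ← Finset.sum_const]
    refine Finset.sum_le_sum fun Kq hKq => ?_
    obtain ⟨q₁, -, rfl⟩ := Finset.mem_image.1 hKq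
    exact hKcard _
  -- §3.8 the count
  have hVcard : V.card ≤ Fintype.card G := by
    rw [hVdef, Finset.card_erase_of_mem (Finset.mem_univ _), Finset.card_univ]; omega
  have hcount' : ∑ v ∈ V, 2 ^ ((Fintype.card (G ⧸ H) + (Finset.univ.filter fun q : G ⧸ H =>
      (v • q) = q ∧ up (v * rep q) = false).card) / 2) < 2 ^ Fintype.card (G ⧸ H) := by
    rw [hn, ← Finset.sum_filter_add_sum_filter_not V (fun v => ∃ q : G ⧸ H, v ∈ K (rep q))]
    have h1 : ∑ v ∈ V₁, 2 ^ ((n + (Finset.univ.filter fun q : G ⧸ H =>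
        (v • q) = q ∧ up (v * rep q) = false).card) / 2) ≤ m * (p - 1) * 2 ^ ((n + n / m) / 2) := by
      calc ∑ v ∈ V₁, 2 ^ ((n + (Finset.univ.filter fun q : G ⧸ H => (v • q) = q ∧ up (v * rep q) = false).card) / 2)
          ≤ ∑ v ∈ V₁, 2 ^ ((n + n / m) / 2) :=
            Finset.sum_le_sum fun v hv => Nat.pow_le_pow_right two_pos (by have := hFix1 v hv; rw [← hsn]; omega)
        _ = V₁.card * 2 ^ ((n + n / m) / 2) := by rw [Finset.sum_const, smul_eq_mul]
        _ ≤ m * (p - 1) * 2 ^ ((n + n / m) / 2) := Nat.mul_le_mul_right _ hV₁card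
    have h0 : ∑ v ∈ V.filter (fun v => ¬ ∃ q : G ⧸ H, v ∈ K (rep q)), 2 ^ ((n + (Finset.univ.filter fun q : G ⧸ H =>
        (v • q) = q ∧ up (v * rep q) = false).card) / 2) ≤ Fintype.card G * 2 ^ (n / 2) := by
      calc ∑ v ∈ V.filter (fun v => ¬ ∃ q : G ⧸ H, v ∈ K (rep q)), 2 ^ ((n + (Finset.univ.filter fun q : G ⧸ H =>
            (v • q) = q ∧ up (v * rep q) = false).card) / 2)
          = ∑ v ∈ V.filter (fun v => ¬ ∃ q : G ⧸ H, v ∈ K (rep q)), 2 ^ (n / 2) :=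
            Finset.sum_congr rfl fun v hv => by
              have hv' := Finset.mem_filter.1 hv
              rw [hFix0 v hv'.1 (fun h => hv'.2 (Finset.mem_filter.1 h).2), Nat.add_zero]
        _ = (V.filter (fun v => ¬ ∃ q : G ⧸ H, v ∈ K (rep q))).card * 2 ^ (n / 2) := by
            rw [Finset.sum_const, smul_eq_mul]
        _ ≤ Fintype.card G * 2 ^ (n / 2) :=
            Nat.mul_le_mul_right _ ((Finset.card_le_card (Finset.filter_subset _ V)).trans hVcard)
    have := hcount m hm₀ hsdiv
    calc _ ≤ m * (p - 1) * 2 ^ ((n + n / m) / 2) + Fintype.card G * 2 ^ (n / 2) := Nat.add_le_add h1 h0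
      _ < 2 ^ n := by omega
  -- §3.9 a section violating every system
  obtain ⟨ε, hε⟩ := SectionCount.exists_forall_violated_fix V
    (fun v (q : G ⧸ H) => v • q) (fun v _ => MulAction.injective v) (fun v q => up (v * rep q)) hcount'
  refine ⟨Finset.univ.filter fun y : G => up y = ε (y : G ⧸ H), hTc ε, fun v hv => ?_, hTu ε⟩
  by_contra hcon
  have hcon' : ∀ x, x ∈ (Finset.univ.filter fun y : G => up y = ε (y : G ⧸ H)) ↔
      v * x ∈ (Finset.univ.filter fun y : G => up y = ε (y : G ⧸ H)) := fun x => by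
    by_contra h; exact hcon ⟨x, h⟩
  obtain ⟨q, hq⟩ := hε v (by rw [hVdef]; exact Finset.mem_erase.2 ⟨hv, Finset.mem_univ v⟩)
  exact hq (hstab ε v hcon' q)

/-- **A NON-NORMAL SUBGROUP OF PRIME ORDER YIELDS A SKEW CM SET.**  `c ≠ 1` a central involution, `u` of prime order `p`,
`⟨u⟩` NOT normal (`g u g⁻¹ ∉ ⟨u⟩` for some `g`), `|G| = 2pn`, and `|G|·2^(n/2) + m(p-1)·2^((n + n/m)/2) < 2^n` for every `m ≥ 2`
dividing `n` ⟹ some `T ⊆ G` has `x ∈ T ↔ cx ∉ T`, trivial left stabiliser and `T u = T`.  (`p = 2`: gen 32's theorem.) [folklore] -/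
theorem exists_skew_of_nonnormal_prime_order (c u : G) (p n : ℕ) [hp : Fact p.Prime]
    (hcc : c * c = 1) (hc1 : c ≠ 1) (hcen : ∀ g : G, c * g = g * c) (hup : u ^ p = 1) (hu1 : u ≠ 1)
    (hcard : Fintype.card G = 2 * p * n) (hnn : ∃ g : G, ∀ k < p, g * u * g⁻¹ ≠ u ^ k)
    (hcount : ∀ m, 2 ≤ m → m ∣ n → Fintype.card G * 2 ^ (n / 2) + m * (p - 1) * 2 ^ ((n + n / m) / 2) < 2 ^ n) :
    ∃ T : Finset G, (∀ x, x ∈ T ↔ c * x ∉ T) ∧ (∀ v : G, v ≠ 1 → ∃ w, ¬ (w ∈ T ↔ v * w ∈ T)) ∧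
      (∀ x, x * u ∈ T ↔ x ∈ T) := by
  have hcU := ne_pow_of_nonnormal hc1 hcen hup hu1 hnn
  obtain ⟨g₀, hg₀⟩ := hnn
  refine exists_skew_of_prime_order_family c u p n 2 hcc hcen hup hu1 hcU hcard
    (fun i => if (i : ℕ) = 0 then 1 else g₀⁻¹) ?_ hcount
  intro i j hij k hk
  fin_cases i <;> fin_cases j
  · exact absurd hij (lt_irrefl _)
  · simpa using hg₀ k hk
  · exact absurd hij (by decide)
  · exact absurd hij (lt_irrefl _)

/-! ## §4 A consequence for pairs of prime-order elements -/

omit [Fintype G] in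
/-- Two elements of prime orders `p`, `q`, each conjugating the other into the cyclic group it generates, COMMUTE: their commutator
lies in `⟨σ⟩ ∩ ⟨τ⟩`, which is trivial unless `⟨σ⟩ = ⟨τ⟩` (prime orders). [folklore] -/
theorem commute_of_conj_eq_pow {σ τ : G} {p q : ℕ} [hp : Fact p.Prime] [hq : Fact q.Prime] (hσ : σ ^ p = 1) (hτ : τ ^ q = 1)
    (hk : ∃ k, τ * σ * τ⁻¹ = σ ^ k) (hl : ∃ l, σ * τ * σ⁻¹ = τ ^ l) : σ * τ = τ * σ := by
  obtain ⟨k, hk⟩ := hk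
  obtain ⟨l, hl⟩ := hl
  have hinvσ : (σ ^ k)⁻¹ = σ ^ (p * k - k) := inv_eq_of_mul_eq_one_left (by
    rw [← pow_add, Nat.sub_add_cancel (Nat.le_mul_of_pos_left k hp.out.pos), pow_mul, hσ, one_pow])
  have hinvτ : τ⁻¹ = τ ^ (q - 1) := inv_eq_of_mul_eq_one_left (by
    rw [← pow_succ, Nat.sub_add_cancel hq.out.pos, hτ])
  have hwσ : σ * τ * σ⁻¹ * τ⁻¹ = σ ^ (1 + (p * k - k)) := by
    rw [pow_add, pow_one, ← hinvσ, ← hk]; group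
  have hwτ : σ * τ * σ⁻¹ * τ⁻¹ = τ ^ (l + (q - 1)) := by rw [hl, pow_add, ← hinvτ]
  by_cases hw : σ * τ * σ⁻¹ * τ⁻¹ = 1
  · calc σ * τ = σ * τ * σ⁻¹ * τ⁻¹ * (τ * σ) := by group
      _ = τ * σ := by rw [hw, one_mul]
  exfalso
  by_cases hpq : p = q
  · subst hpq
    have hσ1 : σ ≠ 1 := fun h => hw (by rw [hwσ, h, one_pow])
    have hτ1 : τ ≠ 1 := fun h => hw (by rw [hwτ, h, one_pow])
    have hordσ : orderOf σ = p := orderOf_eq_prime hσ hσ1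
    have hordτ : orderOf τ = p := orderOf_eq_prime hτ hτ1
    have hmemσ : σ * τ * σ⁻¹ * τ⁻¹ ∈ (Finset.range p).image (fun i => 1 * σ ^ i * 1⁻¹) :=
      Finset.mem_image.2 ⟨(1 + (p * k - k)) % p, Finset.mem_range.2 (Nat.mod_lt _ hp.out.pos), by
        rw [one_mul, inv_one, mul_one, ← hordσ, pow_mod_orderOf, hordσ, hwσ]⟩
    have hmemτ : σ * τ * σ⁻¹ * τ⁻¹ ∈ (Finset.range p).image (fun i => 1 * τ ^ i * 1⁻¹) :=
      Finset.mem_image.2 ⟨(l + (p - 1)) % p, Finset.mem_range.2 (Nat.mod_lt _ hp.out.pos), by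
        rw [one_mul, inv_one, mul_one, ← hordτ, pow_mod_orderOf, hordτ, hwτ]⟩
    have e := (image_conj_pow_eq_of_mem hordσ hw hmemσ).trans (image_conj_pow_eq_of_mem hordτ hw hmemτ).symm
    have hτmem : τ ∈ (Finset.range p).image (fun i => 1 * σ ^ i * 1⁻¹) := by
      rw [e]; exact Finset.mem_image.2 ⟨1, Finset.mem_range.2 hp.out.one_lt, by rw [pow_one, one_mul, inv_one, mul_one]⟩
    obtain ⟨i, -, hi⟩ := Finset.mem_image.1 hτmem
    rw [one_mul, inv_one, mul_one] at hi
    apply hw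
    rw [← hi, (Commute.pow_right (Commute.refl σ) i).eq, mul_inv_cancel_right, mul_inv_cancel]
  · have hp1 : (σ * τ * σ⁻¹ * τ⁻¹) ^ p = 1 := by rw [hwσ, ← pow_mul, mul_comm, pow_mul, hσ, one_pow]
    have hq1 : (σ * τ * σ⁻¹ * τ⁻¹) ^ q = 1 := by rw [hwτ, ← pow_mul, mul_comm, pow_mul, hτ, one_pow]
    have hcop : Nat.Coprime p q := (Nat.coprime_primes hp.out hq.out).2 hpq
    have h1 : orderOf (σ * τ * σ⁻¹ * τ⁻¹) ∣ 1 := by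
      rw [← hcop]; exact Nat.dvd_gcd (orderOf_dvd_of_pow_eq_one hp1) (orderOf_dvd_of_pow_eq_one hq1)
    exact hw (orderOf_eq_one_iff.1 (Nat.dvd_one.1 h1))

end Summit.HodgeConjecture.CorCM.GaloisModels.SkewSectionPrime
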